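import Literature.NumberTheory.EllipticCurves.MultiplicativeUnipotentTorsionProofs
import HarnessLib

/-!
# At a multiplicative place `v ∤ p` the inertia group acts on `E(K̄_v)[p^n]` through `(1 *; 0 1)`
# in ONE basis: the common Tate line (Silverman *ATAEC* V.4–V.5, Ex. 5.13 (b))

`Proofs` file (theorems only: no definition, no named fact), topic `NumberTheory/EllipticCurves`;
sequel of `MultiplicativeUnipotentTorsionProofs`, whose main theorem
`WeierstrassCurve.smul_smul_sub_eq_of_mem_inertia_of_hasMultiplicativeReductionAt` exports only the
consequence `(τ - 1)² = 0` for EACH inertia element `τ` separately — which does not control the group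
generated by the inertia image at prime-power level (in `GL₂(ℤ/p^{2m})` the matrices `1 + p^m A`,
`tr A = 0`, form a subgroup of order `p^{3m}` whose elements all satisfy `(g - 1)² = 0`, `det g = 1`).
The theory of the Tate curve (Silverman, *Advanced Topics in the Arithmetic of Elliptic Curves*,
V.4–V.5 and Exercise 5.13 (b): inertia acts on `E_q[p^n] = ⟨ζ_{p^n}, q^{1/p^n}⟩` through `(1 *; 0 1)`;
Serre, *Abelian ℓ-adic representations* (1968), IV, A.1.2) gives a basis `(P₁, P₂)` of `E[p^n]`, the
SAME for all inertia elements, with `P₁` fixed and `P₂` moved into the line `ℤ P₁`.  This file proves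
that, for an elliptic curve `E = W` over a number field `K`, a finite place `v` of multiplicative
reduction, a prime `p` with `v ∤ p` and `n ≥ 1`, WITHOUT the Tate curve (steps (i)–(ii) below are the
template's, repeated verbatim — adapted from `MultiplicativeUnipotentTorsionProofs`; step (iii) is new):

* (private) `exists_mulVec_sub_eq_smul_of_mulVec_eq_of_det_eq_one` —
  a `2 × 2` matrix `M` over a commutative ring with `M c = c`, `c` with a unit entry, and `det M = 1`
  moves EVERY vector into the line of `c`: `M u - u ∈ R c`;
* (private) `exists_forall_eq_smul_add_smul` — a vector with a unit entry is the first vector of a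
  basis of `R²`;
* `WeierstrassCurve.exists_tateBasis_localPoints_of_hasMultiplicativeReductionAt` — **for the inertia
  group `I_𝔐 ≤ Γ_{K_v}` there are `P₁, P₂ ∈ E(K̄_v)` with `p^n P₁ = p^n P₂ = O`, `p^{n-1} P₁ ≠ O`,
  generating `E(K̄_v)[p^n]` (`Q = a P₁ + b P₂` whenever `p^n Q = O`), such that EVERY `τ ∈ I_𝔐`
  fixes `P₁` and `τ P₂ - P₂ ∈ ℕ P₁`.**

Proof.  (i) On the `𝒪_w`-model `W₀` of the minimal model at `v` over the valuation ring of `K̄_v`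
(reduction a node, `r : E₀ → k^×`) a preimage of a primitive `p^n`-th root of unity, corrected inside
`E₁`, is a point `P₁ ∈ E₀` with `p^n P₁ = O`, `r(P₁)` primitive (so `p^{n-1} P₁ ≠ O`), fixed by every
inertia element (inertia does not move reductions; reduction is injective on prime-to-`v` torsion of
`E₀`).  (ii) In a frame `E[p^n] ≅ (ℤ/p^n)²` the coordinate vector `c` of `P₁` has a unit entry and the
matrix `M` of `τ ∈ I_𝔐` has `M c = c`, `det M = χ_{p^n}(τ) = 1` (Weil pairing; inertia fixes
`μ_{p^n}`).  (iii) Complete `c` to a basis `(c, d)`; then `M d - d ∈ (ℤ/p^n) c`; pull `d` back to `P₂`.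
(iv) Transport along `E(K̄_v) ≃ X(K̄_v)` (`exists_addEquiv_localPoints_of_smul_eq`).

The GLOBAL form (`I_𝔓 ≤ Γ_K` on `E[p^n] ⊆ E(K̄)`), "the image of `I_𝔓` in `Aut(E[p^n])` has order
dividing `p^n`", and [IUTchIV] Prop. 1.8 (vii) second sentence (`e ∣ n`) at every level `n` prime to
`v` are in the sequel `DivisionFieldRamificationPrimePowProofs`.  Classical, undisputed material (cell
abc-iut, campaign S, node IUTchIV:Prop1.8(vii)); nothing here bears on [IUTchIII] Cor. 3.12.
No definitions; `set_option maxHeartbeats` raised for the main proof exactly as in the template.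

## References

* [SilvermanATAEC1994] J. H. Silverman, *Advanced Topics in the Arithmetic of Elliptic Curves*,
  GTM 151 (1994): V.4–V.5 (Tate curve), Exercise 5.13 (b); Cor. IV.9.2 (d).
* [SilvermanAEC2009] J. H. Silverman, *The Arithmetic of Elliptic Curves*, 2nd ed. (2009):
  VII.2.1–VII.2.2, VII.3.1, III.8 (Weil pairing).
* [SerreAbelianLadic1968] J.-P. Serre, *Abelian `ℓ`-adic representations and elliptic curves*
  (1968), Ch. IV, A.1.2.
* [Mochizuki2012] S. Mochizuki, *Inter-universal Teichmüller theory IV*, Prop. 1.8 (vii), p. 19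
  (consumer locator only).
-/

noncomputable section

open scoped Classical NNReal
open NumberField IsDedekindDomain

universe u

/-! ## Linear algebra: a matrix of determinant one fixing a unimodular vector -/

namespace Literature.NumberTheory.EllipticCurves

open Matrix

/-- **A `2 × 2` matrix of determinant `1` fixing a vector with a unit entry moves every vector into
the line of that vector**: if `M c = c` with `c = (x, y)`, `x` (or `y`) a unit, and `det M = 1`, then
for every `u` there is a scalar `m` with `M u - u = m c` (with `s x = 1`:
`M - 1 = M₀₁ · (-s y, 1; -s² y², s y)`, whose columns are multiples of `c`). [folklore] -/
private theorem exists_mulVec_sub_eq_smul_of_mulVec_eq_of_det_eq_one {R : Type*} [CommRing R]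
    (M : Matrix (Fin 2) (Fin 2) R) (c : Fin 2 → R) (hc : IsUnit (c 0) ∨ IsUnit (c 1))
    (hMc : M *ᵥ c = c) (hdet : M.det = 1) (u : Fin 2 → R) :
    ∃ m : R, M *ᵥ u - u = m • c := by
  have h1 : M 0 0 * c 0 + M 0 1 * c 1 = c 0 := by
    have := congrFun hMc 0
    simpa [Matrix.mulVec, dotProduct, Fin.sum_univ_two] using this
  have h2 : M 1 0 * c 0 + M 1 1 * c 1 = c 1 := by
    have := congrFun hMc 1
    simpa [Matrix.mulVec, dotProduct, Fin.sum_univ_two] using this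
  rw [Matrix.det_fin_two] at hdet
  have hu0 : (M *ᵥ u - u) 0 = M 0 0 * u 0 + M 0 1 * u 1 - u 0 := by
    rw [Pi.sub_apply, Matrix.mulVec_apply_eq_sum, Fin.sum_univ_two]
  have hu1 : (M *ᵥ u - u) 1 = M 1 0 * u 0 + M 1 1 * u 1 - u 1 := by
    rw [Pi.sub_apply, Matrix.mulVec_apply_eq_sum, Fin.sum_univ_two]
  rcases hc with hx | hy
  · obtain ⟨s, hs⟩ := hx.exists_left_inv
    have ha : M 0 0 = 1 - s * M 0 1 * c 1 := by linear_combination s * h1 - (M 0 0 - 1) * hs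
    have hc' : M 1 0 = s * (1 - M 1 1) * c 1 := by linear_combination s * h2 - M 1 0 * hs
    have hd : M 1 1 = 1 + s * M 0 1 * c 1 := by
      linear_combination hdet - M 1 1 * ha + M 0 1 * hc'
    refine ⟨s * M 0 1 * (u 1 - s * c 1 * u 0), funext fun i ↦ ?_⟩
    fin_cases i
    · show (M *ᵥ u - u) 0 = s * M 0 1 * (u 1 - s * c 1 * u 0) * c 0
      rw [hu0]
      linear_combination u 0 * ha + (-(M 0 1 * (u 1 - s * c 1 * u 0))) * hs
    · show (M *ᵥ u - u) 1 = s * M 0 1 * (u 1 - s * c 1 * u 0) * c 1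
      rw [hu1]
      linear_combination u 0 * hc' + (u 1 - s * c 1 * u 0) * hd
  · obtain ⟨s, hs⟩ := hy.exists_left_inv
    have hd : M 1 1 = 1 - s * M 1 0 * c 0 := by linear_combination s * h2 - (M 1 1 - 1) * hs
    have hb : M 0 1 = s * (1 - M 0 0) * c 0 := by linear_combination s * h1 - M 0 1 * hs
    have ha : M 0 0 = 1 + s * M 1 0 * c 0 := by
      linear_combination hdet - M 0 0 * hd + M 1 0 * hb
    refine ⟨s * M 1 0 * (u 0 - s * c 0 * u 1), funext fun i ↦ ?_⟩
    fin_cases i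
    · show (M *ᵥ u - u) 0 = s * M 1 0 * (u 0 - s * c 0 * u 1) * c 0
      rw [hu0]
      linear_combination u 1 * hb + (u 0 - s * c 0 * u 1) * ha
    · show (M *ᵥ u - u) 1 = s * M 1 0 * (u 0 - s * c 0 * u 1) * c 1
      rw [hu1]
      linear_combination u 1 * hd + (-(M 1 0 * (u 0 - s * c 0 * u 1))) * hs

/-- **A vector with a unit entry is the first vector of a basis of `R²`**: if `c = (x, y)` with `x`
(or `y`) a unit, then for `d = (0, 1)` (resp. `(1, 0)`) every `u` is `a c + b d`. [folklore] -/
private theorem exists_forall_eq_smul_add_smul {R : Type*} [CommRing R] (c : Fin 2 → R)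
    (hc : IsUnit (c 0) ∨ IsUnit (c 1)) :
    ∃ d : Fin 2 → R, ∀ u : Fin 2 → R, ∃ a b : R, u = a • c + b • d := by
  rcases hc with hx | hy
  · obtain ⟨s, hs⟩ := hx.exists_left_inv
    refine ⟨![0, 1], fun u ↦ ⟨s * u 0, u 1 - s * u 0 * c 1, funext fun i ↦ ?_⟩⟩
    fin_cases i
    · show u 0 = s * u 0 * c 0 + (u 1 - s * u 0 * c 1) * 0
      linear_combination (-(u 0)) * hs
    · show u 1 = s * u 0 * c 1 + (u 1 - s * u 0 * c 1) * 1
      ring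
  · obtain ⟨s, hs⟩ := hy.exists_left_inv
    refine ⟨![1, 0], fun u ↦ ⟨s * u 1, u 0 - s * u 1 * c 0, funext fun i ↦ ?_⟩⟩
    fin_cases i
    · show u 0 = s * u 1 * c 0 + (u 0 - s * u 1 * c 0) * 1
      ring
    · show u 1 = s * u 1 * c 1 + (u 0 - s * u 1 * c 0) * 0
      linear_combination (-(u 1)) * hs

end Literature.NumberTheory.EllipticCurves

namespace WeierstrassCurve

open Literature.NumberTheory.EllipticCurves Literature.NumberTheory.GaloisRepresentations Field
  IsDedekindDomain.HeightOneSpectrum Matrix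

variable {K : Type u} [Field K] [NumberField K] {v : HeightOneSpectrum (𝓞 K)}
  (W : WeierstrassCurve K)

set_option maxHeartbeats 4000000 in
/-- **At a multiplicative place `v ∤ p` the inertia group acts on `E(K̄_v)[p^n]` through
`(1 *; 0 1)` in one basis.**  Let `E/K` be an elliptic curve over a number field, `v` a finite place
of multiplicative reduction, `p` a prime with `v ∤ p`, `n ≥ 1` and `𝔐` the prime of `\bar 𝓞_v`
above `𝓂_v`.  Then there are `P₁, P₂ ∈ E(K̄_v)` with `p^n P₁ = p^n P₂ = O`, `p^{n-1} P₁ ≠ O`, such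
that every `Q ∈ E(K̄_v)` with `p^n Q = O` is `a P₁ + b P₂` (`a, b ∈ ℕ`), and for EVERY `τ` in the
inertia group `I_𝔐 ≤ Γ_{K_v}`: `τ P₁ = P₁` and `τ P₂ - P₂ = m P₁` for some `m ∈ ℕ` (Tate curve:
`P₁ = ζ_{p^n}`, `P₂ = q^{1/p^n}`; proof without the Tate curve in the module docstring).
[cite: SilvermanATAEC1994, V.4–V.5 (Tate curve), Exercise 5.13(b), Cor. IV.9.2(d)]
[cite: SilvermanAEC2009, VII.2.1, VII.2.2, VII.3.1, III.8] [cite: SerreAbelianLadic1968, Ch. IV, A.1.2] -/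
theorem exists_tateBasis_localPoints_of_hasMultiplicativeReductionAt [W.IsElliptic]
    (hmult : W.HasMultiplicativeReductionAt v) {p : ℕ} (hp : p.Prime) (hpv : (p : 𝓞 K) ∉ v.asIdeal)
    {n : ℕ} (hn : 1 ≤ n)
    {w : Valuation (AlgebraicClosure (v.adicCompletion K)) ℝ≥0}
    (hw : ∀ x, (w x : ℝ) =
      spectralNorm (v.adicCompletion K) (AlgebraicClosure (v.adicCompletion K)) x)
    {𝔐 : Ideal v.localAbsIntegers} (h𝔐 : 𝔐 ∈ v.localPrimesAbove) :
    ∃ P₁ P₂ : localPoints W (v.adicCompletion K),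
      p ^ n • P₁ = 0 ∧ p ^ n • P₂ = 0 ∧ p ^ (n - 1) • P₁ ≠ 0 ∧
      (∀ Q : localPoints W (v.adicCompletion K), p ^ n • Q = 0 → ∃ a b : ℕ, Q = a • P₁ + b • P₂) ∧
      ∀ τ ∈ 𝔐.inertia (absoluteGaloisGroup (v.adicCompletion K)),
        τ • P₁ = P₁ ∧ ∃ m : ℕ, τ • P₂ - P₂ = m • P₁ := by
  have hv0 : w.Integers w.integer := Valuation.integer.integers w
  haveI := henselianRing_integer w
  haveI := isAlgClosed_residueField_integer w
  haveI : Fact p.Prime := ⟨hp⟩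
  -- models
  set X := W.localMinimalModel v with hXdef
  haveI : X.IsElliptic := W.isElliptic_localMinimalModel v
  have hint : (X.baseChange (AlgebraicClosure (v.adicCompletion K))).IsIntegral w.integer := by
    have := isIntegral_spectralValuation_baseChange hw
      (X.integralModel (v.adicCompletionIntegers K))
    rwa [show (X.integralModel (v.adicCompletionIntegers K)).map
        (algebraMap (v.adicCompletionIntegers K) (v.adicCompletion K)) = X from
      baseChange_integralModel_eq (v.adicCompletionIntegers K) X] at this
  haveI := hint
  obtain ⟨W₀, hW₀⟩ := hint.integral
  -- the reduction of `W₀` is a node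
  have hΔeq : algebraMap w.integer (AlgebraicClosure (v.adicCompletion K)) W₀.Δ =
      algebraMap (v.adicCompletion K) (AlgebraicClosure (v.adicCompletion K))
        (algebraMap (v.adicCompletionIntegers K) (v.adicCompletion K)
          (X.integralModel (v.adicCompletionIntegers K)).Δ) := by
    rw [integralModel_Δ_eq, ← map_Δ, ← map_Δ]
    change (W₀.baseChange (AlgebraicClosure (v.adicCompletion K))).Δ =
      (X.baseChange (AlgebraicClosure (v.adicCompletion K))).Δ
    rw [hW₀]
  have hc₄eq : algebraMap w.integer (AlgebraicClosure (v.adicCompletion K)) W₀.c₄ =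
      algebraMap (v.adicCompletion K) (AlgebraicClosure (v.adicCompletion K))
        (algebraMap (v.adicCompletionIntegers K) (v.adicCompletion K)
          (X.integralModel (v.adicCompletionIntegers K)).c₄) := by
    rw [integralModel_c₄_eq, ← map_c₄, ← map_c₄]
    change (W₀.baseChange (AlgebraicClosure (v.adicCompletion K))).c₄ =
      (X.baseChange (AlgebraicClosure (v.adicCompletion K))).c₄
    rw [hW₀]
  have hΔ : IsLocalRing.residue w.integer W₀.Δ = 0 := by
    have hlt := (show X.HasMultiplicativeReduction (v.adicCompletionIntegers K) from hmult).badReduction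
    rw [← integralModel_Δ_eq (v.adicCompletionIntegers K) X] at hlt
    have hmem := (IsDedekindDomain.HeightOneSpectrum.valuation_lt_one_iff_mem _ _).mp hlt
    rw [← v_algebraMap_lt_one_iff hv0, hΔeq]
    exact spectralValuation_algebraMap_lt_one_of_mem_maximalIdeal hw h𝔐 hmem
  have hc₄ : IsLocalRing.residue w.integer W₀.c₄ ≠ 0 := by
    have heq := (show X.HasMultiplicativeReduction (v.adicCompletionIntegers K) from
      hmult).multiplicativeReduction
    rw [← integralModel_c₄_eq (v.adicCompletionIntegers K) X] at heq
    have hnot : (X.integralModel (v.adicCompletionIntegers K)).c₄ ∉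
        IsLocalRing.maximalIdeal (v.adicCompletionIntegers K) := fun hmem ↦ by
      have := (IsDedekindDomain.HeightOneSpectrum.valuation_lt_one_iff_mem
        (K := v.adicCompletion K)
        (IsDiscreteValuationRing.maximalIdeal (v.adicCompletionIntegers K)) _).mpr hmem
      rw [heq] at this
      exact lt_irrefl _ this
    have hunit : IsUnit (X.integralModel (v.adicCompletionIntegers K)).c₄ := by
      by_contra hu
      exact hnot ((IsLocalRing.mem_maximalIdeal _).mpr hu)
    rw [← v_algebraMap_eq_one_iff hv0, hc₄eq]
    exact spectralValuation_eq_one_of_isUnit hw hunit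
  obtain ⟨rn, hrn_surj, hrn⟩ := W₀.exists_addMonoidHom_units_of_node_of_isAlgClosed hv0 hΔ hc₄
  -- transport `E(K̄_v) ≃ X(K̄_v)`
  obtain ⟨C, hC⟩ := W.exists_variableChange_smul_eq_localMinimalModel v
  obtain ⟨Φ, hΦ⟩ := W.exists_addEquiv_localPoints_of_smul_eq v hC
  -- valuations of `p`
  have hpnv : ((p ^ n : ℕ) : 𝓞 K) ∉ v.asIdeal := v.natCast_pow_not_mem hpv n
  have hpnw : w (((p ^ n : ℕ) : ℤ) : AlgebraicClosure (v.adicCompletion K)) = 1 :=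
    spectralValuation_intCast_eq_one hw (n := ((p ^ n : ℕ) : ℤ)) (by simpa using hpnv)
  have hpk : ((p : ℕ) : IsLocalRing.ResidueField w.integer) ≠ 0 := by
    have hpw : w ((p : ℤ) : AlgebraicClosure (v.adicCompletion K)) = 1 :=
      spectralValuation_intCast_eq_one hw (n := (p : ℤ)) (by simpa using hpv)
    have hpw' : w (algebraMap w.integer (AlgebraicClosure (v.adicCompletion K)) (p : w.integer)) = 1 := by
      rw [map_natCast]; exact_mod_cast hpw
    have h1 : IsLocalRing.residue w.integer (p : w.integer) ≠ 0 :=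
      (v_algebraMap_eq_one_iff hv0 _).mp hpw'
    simpa using h1
  haveI hpnk : NeZero (((p ^ n : ℕ) : ℕ) : IsLocalRing.ResidueField w.integer) :=
    ⟨by rw [Nat.cast_pow]; exact pow_ne_zero _ hpk⟩
  haveI : CharZero (v.adicCompletion K) :=
    charZero_of_injective_algebraMap (algebraMap K (v.adicCompletion K)).injective
  have hpF : (p : v.adicCompletion K) ≠ 0 := Nat.cast_ne_zero.mpr hp.ne_zero
  haveI hpnF : NeZero (((p ^ n : ℕ) : ℕ) : v.adicCompletion K) :=
    ⟨by rw [Nat.cast_pow]; exact pow_ne_zero _ hpF⟩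
  /- (i) a point `P₁ ∈ E₀(X)` with `p^n P₁ = O`, `r(P₁) = b` primitive, fixed by inertia -/
  obtain ⟨b₀, hb₀⟩ := HasEnoughRootsOfUnity.exists_primitiveRoot
    (IsLocalRing.ResidueField w.integer) (p ^ n)
  have hb₀unit : IsUnit b₀ := hb₀.isUnit (pow_ne_zero _ hp.ne_zero)
  set b : (IsLocalRing.ResidueField w.integer)ˣ := hb₀unit.unit with hbdef
  have hb : IsPrimitiveRoot b (p ^ n) := by
    refine IsPrimitiveRoot.of_map_of_injective (f := Units.coeHom _) ?_ Units.val_injective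
    rw [Units.coeHom_apply, hbdef, IsUnit.unit_spec]
    exact hb₀
  have hbpow : (p ^ n : ℕ) • (Additive.ofMul b) = 0 := by
    rw [← ofMul_pow, hb.pow_eq_one, ofMul_one]
  obtain ⟨P₀, hP₀⟩ := hrn_surj (Additive.ofMul b)
  set S₀ := (Affine.Point.congrEquiv hW₀).symm
    (P₀ : (W₀.baseChange (AlgebraicClosure (v.adicCompletion K))).toAffine.Point) with hS₀
  have hcS₀ : Affine.Point.congrEquiv hW₀ S₀ = P₀ := by rw [hS₀, AddEquiv.apply_symm_apply]
  have hS₀E₀ : W₀.HasNonsingularReduction (Affine.Point.congrEquiv hW₀ S₀) := by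
    rw [hcS₀]; exact P₀.2
  -- `p^n • S₀ ∈ E₁`
  have hker : W₀.ReducesToZero (Affine.Point.congrEquiv hW₀ ((p ^ n : ℕ) • S₀)) := by
    have h1 : rn ((p ^ n : ℕ) • P₀) = 0 := by rw [map_nsmul, hP₀, hbpow]
    have h2 := (hrn _).mp h1
    rwa [AddSubgroup.coe_nsmul, ← hcS₀, ← map_nsmul] at h2
  -- a torsion point `P₁ ∈ E₀` with `rn`-image `b`
  obtain ⟨P₁, hP₁E₀, hP₁tors, hP₁img⟩ :
      ∃ P₁ : (X.baseChange (AlgebraicClosure (v.adicCompletion K))).toAffine.Point,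
        ∃ hE₀ : W₀.HasNonsingularReduction (Affine.Point.congrEquiv hW₀ P₁),
          (p ^ n : ℕ) • P₁ = 0 ∧ rn ⟨Affine.Point.congrEquiv hW₀ P₁, hE₀⟩ = Additive.ofMul b := by
    rcases hT : ((p ^ n : ℕ) • S₀) with _ | ⟨x, y, hxy⟩
    · refine ⟨S₀, hS₀E₀, by rw [hT, Affine.Point.zero_def], ?_⟩
      rw [← hP₀]; congr 1; exact Subtype.ext hcS₀
    · have hx : 1 < w x := by
        rw [hT, Affine.Point.congrEquiv_some, reducesToZero_some_iff, not_mem_range_iff hv0] at hker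
        exact hker
      obtain ⟨x', y', hxy', hx', hdivpt⟩ := exists_zsmul_eq_of_one_lt_val (w := w)
        (V := X.baseChange (AlgebraicClosure (v.adicCompletion K)))
        (m := ((p ^ n : ℕ) : ℤ)) hpnw hxy hx
      set Q₁ : (X.baseChange (AlgebraicClosure (v.adicCompletion K))).toAffine.Point :=
        .some x' y' hxy' with hQ₁
      have hQ₁E₁ : W₀.ReducesToZero (Affine.Point.congrEquiv hW₀ Q₁) := by
        rw [hQ₁, Affine.Point.congrEquiv_some, reducesToZero_some_iff, not_mem_range_iff hv0]
        exact hx'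
      have hE₀' : W₀.HasNonsingularReduction (Affine.Point.congrEquiv hW₀ (S₀ - Q₁)) := by
        rw [map_sub]
        exact (W₀.nonsingularReductionSubgroup hv0).sub_mem hS₀E₀ hQ₁E₁.hasNonsingularReduction
      have hdivpt' : ((p ^ n : ℕ) : ℤ) • Q₁ = Affine.Point.some x y hxy := by
        rw [hQ₁]; exact hdivpt
      refine ⟨S₀ - Q₁, hE₀', ?_, ?_⟩
      · rw [nsmul_sub, hT, ← natCast_zsmul (Q₁), hdivpt', sub_self]
      · have hsplit : (⟨Affine.Point.congrEquiv hW₀ (S₀ - Q₁), hE₀'⟩ :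
            W₀.nonsingularReductionSubgroup hv0) =
            ⟨Affine.Point.congrEquiv hW₀ S₀, hS₀E₀⟩ -
              ⟨Affine.Point.congrEquiv hW₀ Q₁, hQ₁E₁.hasNonsingularReduction⟩ :=
          Subtype.ext (by
            change Affine.Point.congrEquiv hW₀ (S₀ - Q₁) =
              Affine.Point.congrEquiv hW₀ S₀ - Affine.Point.congrEquiv hW₀ Q₁
            rw [map_sub])
        rw [hsplit, map_sub,
          (hrn ⟨Affine.Point.congrEquiv hW₀ Q₁, hQ₁E₁.hasNonsingularReduction⟩).mpr hQ₁E₁,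
          sub_zero, ← hP₀]
        congr 1; exact Subtype.ext hcS₀
  -- `P₁` is fixed by the inertia group
  have hP₁fix : ∀ σ ∈ 𝔐.inertia (absoluteGaloisGroup (v.adicCompletion K)),
      Affine.Point.map ((absoluteGaloisGroup.toAlgEquiv _ σ :
          AlgebraicClosure (v.adicCompletion K) ≃ₐ[v.adicCompletion K]
            AlgebraicClosure (v.adicCompletion K)) :
          AlgebraicClosure (v.adicCompletion K) →ₐ[v.adicCompletion K]
            AlgebraicClosure (v.adicCompletion K)) P₁ = P₁ := by
    intro σ hσ
    obtain ⟨hσ₁, hσ₂⟩ := isometry_of_mem_inertia hw h𝔐 hσ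
    have hE₀σ := (W₀.hasNonsingularReduction_congrEquiv_map_iff hW₀
      ((absoluteGaloisGroup.toAlgEquiv _ σ :
          AlgebraicClosure (v.adicCompletion K) ≃ₐ[v.adicCompletion K]
            AlgebraicClosure (v.adicCompletion K)) :
          AlgebraicClosure (v.adicCompletion K) →ₐ[v.adicCompletion K]
            AlgebraicClosure (v.adicCompletion K)) hσ₁ hσ₂ P₁).mpr hP₁E₀
    have hred := W₀.reducePoint_congrEquiv_map_eq hW₀
      ((absoluteGaloisGroup.toAlgEquiv _ σ :
          AlgebraicClosure (v.adicCompletion K) ≃ₐ[v.adicCompletion K]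
            AlgebraicClosure (v.adicCompletion K)) :
          AlgebraicClosure (v.adicCompletion K) →ₐ[v.adicCompletion K]
            AlgebraicClosure (v.adicCompletion K)) hσ₁ hσ₂ P₁
    have key := W₀.eq_of_reducePoint_eq_of_zsmul_eq_zero hpnw hE₀σ hP₁E₀
      (by rw [← map_zsmul, ← map_zsmul, natCast_zsmul, hP₁tors, map_zero, map_zero])
      (by rw [← map_zsmul, natCast_zsmul, hP₁tors, map_zero]) hred
    exact (Affine.Point.congrEquiv hW₀).injective key
  -- `P₁` has order exactly `p^n`: `p^(n-1) • P₁ ≠ 0`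
  have hP₁ord : (p ^ (n - 1) : ℕ) • P₁ ≠ 0 := by
    intro h0
    have hmul : rn ((p ^ (n - 1) : ℕ) • ⟨Affine.Point.congrEquiv hW₀ P₁, hP₁E₀⟩) = 0 := by
      have : ((p ^ (n - 1) : ℕ) • (⟨Affine.Point.congrEquiv hW₀ P₁, hP₁E₀⟩ :
          W₀.nonsingularReductionSubgroup hv0)) = 0 :=
        Subtype.ext (by
          change (p ^ (n - 1) : ℕ) • Affine.Point.congrEquiv hW₀ P₁ = 0
          rw [← map_nsmul, h0, map_zero])
      rw [this, map_zero]
    rw [map_nsmul, hP₁img, ← ofMul_pow, ofMul_eq_zero, hb.pow_eq_one_iff_dvd] at hmul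
    have hlt : p ^ (n - 1) < p ^ n := Nat.pow_lt_pow_right hp.one_lt (by omega)
    exact absurd (Nat.le_of_dvd (pow_pos hp.pos _) hmul) (not_le.mpr hlt)
  /- (ii) the frame on `X[p^n]`, the coordinate vector `c` of `P₁` and a complement `d` -/
  obtain ⟨e⟩ := nonempty_addEquiv_geomTorsion X p n hn hpF
  obtain ⟨ρ, hρ⟩ := exists_rep_of_addEquiv X e
  haveI : NeZero (p ^ n) := ⟨pow_ne_zero _ hp.ne_zero⟩
  have hP₁mem : (P₁ : geomPoints X) ∈ geomTorsion X ((p ^ n : ℕ) : ℤ) :=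
    (Submodule.mem_torsionBy_iff _ _).mpr
      (show ((p ^ n : ℕ) : ℤ) • P₁ = 0 by rw [natCast_zsmul]; exact hP₁tors)
  set P₁' : geomTorsion X ((p ^ n : ℕ) : ℤ) := ⟨(P₁ : geomPoints X), hP₁mem⟩ with hP₁'
  set c : Fin 2 → ZMod (p ^ n) := e P₁' with hcdef
  -- `c` has a unit entry
  have hc : IsUnit (c 0) ∨ IsUnit (c 1) := by
    by_contra hcon
    rw [not_or] at hcon
    have hn0 : n ≠ 0 := by omega
    have hred0 : ∀ i, ZMod.castHom (dvd_pow_self p hn0) (ZMod p) (c i) = 0 := by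
      intro i
      by_contra hne
      have hu := TransvectionLifting.isUnit_of_cast_ne_zero hn0 hne
      fin_cases i
      · exact hcon.1 hu
      · exact hcon.2 hu
    have hpc : (p ^ (n - 1) : ℕ) • c = 0 := by
      funext i
      obtain ⟨c', hc'⟩ := Serre1968.exists_eq_mul_of_cast_eq_zero hn0 (c i) (hred0 i)
      rw [Pi.smul_apply, Pi.zero_apply, hc', nsmul_eq_mul, ← mul_assoc, Nat.cast_pow,
        ← pow_succ, Nat.sub_add_cancel hn, Serre1968.natCast_pow_eq_zero, zero_mul]
    apply hP₁ord
    have h1 : (p ^ (n - 1) : ℕ) • P₁' = 0 := e.injective (by rw [map_nsmul, map_zero]; exact hpc)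
    have h2 := congrArg (fun Q : geomTorsion X ((p ^ n : ℕ) : ℤ) ↦ ((Q : geomPoints X))) h1
    simp only [AddSubmonoidClass.coe_nsmul, ZeroMemClass.coe_zero] at h2
    exact h2
  -- a complement `d` of `c`, pulled back to `P₂' ∈ X[p^n]`
  obtain ⟨d, hd⟩ := exists_forall_eq_smul_add_smul c hc
  set P₂' : geomTorsion X ((p ^ n : ℕ) : ℤ) := e.symm d with hP₂'
  have heP₂' : e P₂' = d := by rw [hP₂', AddEquiv.apply_symm_apply]
  -- scalars of `ZMod (p^n)` act through `ℕ`
  have hcast : ∀ (a : ZMod (p ^ n)) (x : Fin 2 → ZMod (p ^ n)), a • x = a.val • x := fun a x ↦ by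
    conv_lhs => rw [← ZMod.natCast_zmod_val a]
    exact Nat.cast_smul_eq_nsmul _ _ _
  -- generation of `X[p^n]` by `P₁', P₂'`
  have hgen : ∀ Q : geomTorsion X ((p ^ n : ℕ) : ℤ), ∃ a b : ℕ, Q = a • P₁' + b • P₂' := by
    intro Q
    obtain ⟨a, b, hab⟩ := hd (e Q)
    refine ⟨a.val, b.val, e.injective ?_⟩
    rw [hab, map_add, map_nsmul, map_nsmul, ← hcdef, heP₂', hcast, hcast]
  /- (iii) for `τ ∈ I_𝔐`: `M c = c`, `det M = 1`, hence `M d - d ∈ (ℤ/p^n) c` -/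
  have hstep : ∀ τ ∈ 𝔐.inertia (absoluteGaloisGroup (v.adicCompletion K)),
      τ • P₁' = P₁' ∧ ∃ m : ℕ, τ • P₂' - P₂' = m • P₁' := by
    intro τ hτ
    set M : Matrix (Fin 2) (Fin 2) (ZMod (p ^ n)) :=
      ((ρ τ : GL (Fin 2) (ZMod (p ^ n))) : Matrix (Fin 2) (Fin 2) (ZMod (p ^ n))) with hM
    have hτP₁' : τ • P₁' = P₁' := Subtype.ext (hP₁fix τ hτ)
    have hMc : M *ᵥ c = c := by rw [hcdef, ← hρ τ P₁', hτP₁']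
    -- `det M = χ_{p^n}(τ) = 1`: `τ` fixes the `p^n`-th roots of unity
    have hdet : M.det = 1 := by
      have hχ := det_eq_modNCyclotomicCharacter X (p ^ n)
        (hp.two_le.trans (Nat.le_self_pow (by omega) p)) e τ M (hρ τ)
      rw [hχ]
      haveI : NeZero (((p ^ n : ℕ) : ℕ) : AlgebraicClosure (v.adicCompletion K)) :=
        ⟨by rw [Nat.cast_pow]; exact pow_ne_zero _ (fun h ↦ hpF
          ((algebraMap (v.adicCompletion K) (AlgebraicClosure (v.adicCompletion K))).injective
            (by rw [map_natCast, map_zero, h])))⟩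
      obtain ⟨ζ, hζ⟩ := HasEnoughRootsOfUnity.exists_primitiveRoot
        (AlgebraicClosure (v.adicCompletion K)) (p ^ n)
      have hunit : IsUnit (((p ^ n : ℕ) : ℕ) :
          (ValuativeRel.valuation (v.adicCompletion K)).integer) := by
        by_contra h1
        rw [Valuation.Integer.not_isUnit_iff_valuation_lt_one] at h1
        have h2 : Valued.v ((((p ^ n : ℕ) : ℕ) :
            (ValuativeRel.valuation (v.adicCompletion K)).integer) : v.adicCompletion K) < 1 :=
          (Valuation.vlt_one_iff (Valued.v : Valuation (v.adicCompletion K)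
            (WithZero (Multiplicative ℤ)))).mp
            ((Valuation.vlt_one_iff (ValuativeRel.valuation (v.adicCompletion K))).mpr h1)
        have h3 : ((((p ^ n : ℕ) : ℕ) : (ValuativeRel.valuation (v.adicCompletion K)).integer) :
            v.adicCompletion K) =
            ((algebraMap (𝓞 K) K ((p ^ n : ℕ) : 𝓞 K) : K) : v.adicCompletion K) := by
          rw [SubringClass.coe_natCast, map_natCast]
          exact (map_natCast (algebraMap K (v.adicCompletion K)) _).symm
        rw [h3, valuedAdicCompletion_eq_valuation', valuation_lt_one_iff_mem] at h2
        exact hpnv h2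
      have hτabs : τ ∈ absInertia (v.adicCompletion K) := by
        rw [← inertia_eq_absInertia hw h𝔐]; exact hτ
      have hfix : τ • ζ = ζ :=
        mem_absInertia_iff_smul_rootsOfUnity.mp hτabs (p ^ n) hunit ζ hζ.pow_eq_one
      have hspec := modNCyclotomicCharacter_spec (v.adicCompletion K) (p ^ n) τ ζ hζ.pow_eq_one
      rw [hfix] at hspec
      have hval : ((modNCyclotomicCharacter (v.adicCompletion K) (p ^ n) τ : (ZMod (p ^ n))ˣ) :
          ZMod (p ^ n)).val = 1 := by
        have h1 : 1 < p ^ n := Nat.one_lt_pow (by omega) hp.one_lt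
        refine (hζ.pow_inj (ZMod.val_lt _) h1 ?_)
        rw [pow_one]; exact hspec.symm
      rw [← ZMod.natCast_zmod_val ((modNCyclotomicCharacter (v.adicCompletion K) (p ^ n) τ :
        (ZMod (p ^ n))ˣ) : ZMod (p ^ n)), hval, Nat.cast_one]
    -- linear algebra: `M d - d = m c`
    obtain ⟨m, hm⟩ := exists_mulVec_sub_eq_smul_of_mulVec_eq_of_det_eq_one M c hc hMc hdet d
    refine ⟨hτP₁', m.val, e.injective ?_⟩
    rw [map_sub, hρ τ P₂', heP₂', hm, map_nsmul, ← hcdef, hcast]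
  /- (iv) transport back to `E(K̄_v)` along `Φ` -/
  refine ⟨Φ.symm (P₁ : geomPoints X), Φ.symm ((P₂' : geomTorsion X ((p ^ n : ℕ) : ℤ)) : geomPoints X),
    ?_, ?_, ?_, ?_, ?_⟩
  · rw [← map_nsmul, hP₁tors, map_zero]
  · have h2 : ((p ^ n : ℕ) : ℤ) • ((P₂' : geomTorsion X ((p ^ n : ℕ) : ℤ)) : geomPoints X) = 0 :=
      (Submodule.mem_torsionBy_iff _ _).mp P₂'.2
    have h3 : (p ^ n : ℕ) • ((P₂' : geomTorsion X ((p ^ n : ℕ) : ℤ)) : geomPoints X) = 0 := by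
      rw [← natCast_zsmul]; exact h2
    rw [← map_nsmul]
    show Φ.symm ((p ^ n : ℕ) • ((P₂' : geomTorsion X ((p ^ n : ℕ) : ℤ)) : geomPoints X)) = 0
    rw [h3]
    exact map_zero Φ.symm
  · rw [← map_nsmul, AddEquiv.map_ne_zero_iff]
    exact hP₁ord
  · intro Q hQ
    have hQmem : (Φ Q : geomPoints X) ∈ geomTorsion X ((p ^ n : ℕ) : ℤ) :=
      (Submodule.mem_torsionBy_iff _ _).mpr
        (show ((p ^ n : ℕ) : ℤ) • Φ Q = 0 by rw [natCast_zsmul, ← map_nsmul, hQ, map_zero])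
    obtain ⟨a, b', hab⟩ := hgen ⟨(Φ Q : geomPoints X), hQmem⟩
    have hab' := congrArg (fun R : geomTorsion X ((p ^ n : ℕ) : ℤ) ↦ ((R : geomPoints X))) hab
    simp only [AddSubmonoidClass.coe_nsmul, AddSubgroup.coe_add] at hab'
    refine ⟨a, b', Φ.injective ?_⟩
    rw [map_add, map_nsmul, map_nsmul, AddEquiv.apply_symm_apply, AddEquiv.apply_symm_apply]
    exact hab'
  · intro τ hτ
    obtain ⟨hτ₁, m, hτ₂⟩ := hstep τ hτ
    refine ⟨Φ.injective ?_, m, Φ.injective ?_⟩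
    · rw [hΦ, AddEquiv.apply_symm_apply]
      exact hP₁fix τ hτ
    · have key := congrArg (fun R : geomTorsion X ((p ^ n : ℕ) : ℤ) ↦ ((R : geomPoints X))) hτ₂
      simp only [AddSubgroupClass.coe_sub,
        Literature.NumberTheory.EllipticCurves.AddSubgroup.torsionBy.coe_smul] at key
      rw [map_sub, hΦ, map_nsmul, AddEquiv.apply_symm_apply, AddEquiv.apply_symm_apply]
      exact key

end WeierstrassCurve

end
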